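import Mathlib
import Summits.NavierStokesRegularity.NavierStokesRegularity.Theorems.SubOnsagerCeilingKPPumpLadder
import Summits.NavierStokesRegularity.NavierStokesRegularity.Theorems.SubOnsagerCeilingKPPumpLadderWitness
import HarnessLib

/-!
# The primary graded barrier at ratio `1+ε₀` (all KP networks proper of `E₂(8)`) ⇒ the ν-uniform super-critical
# barrier for the Katz–Pavlović CHAIN at ratio `(1+ε₀)^{1/4}` — stated for chain solutions
(helper file for crux stmt-NavierStokesRegularity-27057 `SubOnsagerCeiling.ForwardTailCeilingKP`, `--supports … --as helper`;
assembles `SubOnsagerCeilingKPPumpLadder` (ladder = chain, grading lemma) with `SubOnsagerCeilingKPPumpLadderWitness`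
(the tuned ladder is an admissible table of `E₂(8)` at every `ε₀ ∈ (0,1]`))

`pumpLadder_quarterRatioChain_barrier`: fix `ε₀ ∈ (0, 1]` and suppose the body of the registered stubs'
`PrimaryGradedAt 8 ε₀ α` holds for EVERY table `α` (this is `Sig.stub_primaryGradedLargeRatio 8 _ ε₀ _ _` of the
skeleton `Cruxes/ForwardTailCeilingKP/Lines/kp_shell_barrier.lean` when `ε₀ > 1/4`, and `Sig.stub_primaryGradedSmallRatio`
when `ε₀ ≤ 1/4`).  Then there are a residue `j ∈ {2, 3}`, an exponent `θ ∈ (1/2, 1]` and `D ≥ 0` such that, uniformly in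
`ν > 0`, EVERY honest solution `z : ℤ → ℝ → ℝ` on `[0, s]` of the positive viscous Katz–Pavlović chain at the scale
ratio `B = (1+ε₀)^{1/4}`,

  `ż_m = c·B^{5(m-1)/2} z²_{m-1} − c·B^{5m/2} z_m z_{m+1} − ν(1+ε₀)^{2k} z_m`   (`m = 4k + i`, `c = (1+ε₀)^{-15/8}`),

from the one-site datum `z_m(0) = A·1_{m=0}` (vanishing at negative sites, Tao's weight bound, continuous, non-negative
at the sites `m ≥ 4`) obeys `(1+ε₀)^{2θk}·½ z_{4k+j}(t)² ≤ D·½A²` for all `t ∈ [0, s]` and all `k ≥ 0` — i.e. the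
super-critical weighted barrier `B^{2θ·4k} ½z² ≤ D E₀` on the residue class `j (mod 4)` of sites, ν-uniformly.
(The chain's equations are written out by residue of `m (mod 4)`; the viscosity profile `ν(1+ε₀)^{2⌊m/4⌋} = νB^{8⌊m/4⌋}`
is the standard `νB^{2m}` up to the factor `B^{-6} ∈ [2^{-3/2}, 1)`.)

READING: the registered stubs contain, BY THIS DECLARATION, the λ-uniform super-critical barrier for the positive
Katz–Pavlović chain at every ratio `B ∈ (1, 2^{1/4}]` — the LARGE-ratio stub alone at every `B ∈ ((5/4)^{1/4}, 2^{1/4}]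
≈ (1.057, 1.189]`, the regime of the smallest measured margin (`θ_eff ≈ 0.60` at `B ≈ 1.10`, hand leafhand-4-g0; reproduced
for the tuned ladder at `1+ε₀ = 1.4641` by this hand) where no certified region exists.  HONEST FRAMING: MODEL lattice
bookkeeping (rung TL-M2Break); no stub, crux or summit is proved; nothing here bears on Navier–Stokes regularity.
[cite: Tao2016AveragedNS, §4 (4.13)] [cite: BarbatoMorandinRomito2011, §3.2 (shape of the barrier)]
-/

noncomputable section

-- the sub-problem namespace `NavierStokesRegularity.NavierStokesRegularity` is the tree's layout (D-0017)
set_option linter.dupNamespace false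

namespace Summit.NavierStokesRegularity.NavierStokesRegularity.Theorems

open Set Finset
open Literature.Analysis.FluidPDE.TaoCascade

/-- **PRIMARY GRADED BARRIER FOR ALL TABLES OF `E₂(8)` AT RATIO `1+ε₀` ⇒ ν-UNIFORM SUPER-CRITICAL BARRIER FOR THE
KATZ–PAVLOVIĆ CHAIN AT RATIO `(1+ε₀)^{1/4}`** (on a residue class of sites `mod 4`), via the tuned in-shell pump ladder.
See the module docstring. MODEL lattice bookkeeping; no stub is proved. [this file] -/
theorem pumpLadder_quarterRatioChain_barrier {ε₀ : ℝ} (hε : 0 < ε₀) (hε1 : ε₀ ≤ 1)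
    (hAll : ∀ α : Fin 4 → Fin 4 → Fin 4 → ℤ × ℤ × ℤ → ℝ,
      Literature.Analysis.FluidPDE.TaoCascade.InTableClass 8 α →
      (∀ (Y : Fin 4 → ℤ → ℝ → ℝ) (τ : ℝ), (∀ (j : Fin 4) (k : ℤ), 1 ≤ k → 0 ≤ Y j k τ) → ∀ δ : ℝ, 0 < δ →
        ∀ (i : Fin 4) (n : ℤ), 1 ≤ n → Y i n τ = 0 → 0 ≤ Literature.Analysis.FluidPDE.TaoCascade.quadTerm δ α Y i n τ) →
      (∀ a b i : Fin 4, a ≠ b → α a b i (0, 0, 1) = 0) →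
      ∃ (lev : Fin 4 → ℕ) (L : ℕ), (∀ a, lev a ≤ L) ∧
        (∀ a, lev a ≠ 0 → (∃ e, α a a e (0, 0, 1) ≠ 0) →
          (∀ j, α j j a (0, 0, 1) ≠ 0 → lev j < lev a ∧ (lev j = 0 ∨ ∃ e', α j j e' (0, 0, 1) ≠ 0)) ∧
          (∀ i₁ i₂, i₁ ≠ a → i₂ ≠ a → α i₁ i₂ a (0, 0, 0) ≠ 0 →
            (lev i₁ < lev a ∧ (lev i₁ = 0 ∨ ∃ e', α i₁ i₁ e' (0, 0, 1) ≠ 0)) ∧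
            (lev i₂ < lev a ∧ (lev i₂ = 0 ∨ ∃ e', α i₂ i₂ e' (0, 0, 1) ≠ 0))) ∧
          (∃ e, α a a e (0, 0, 1) ≠ 0 ∧
            (∀ j, α e e j (0, 0, 1) ≠ 0 → lev j < lev a ∧ (lev j = 0 ∨ ∃ e', α j j e' (0, 0, 1) ≠ 0)) ∧
            (∀ j, j ≠ e → α e e j (0, 0, 0) ≠ 0 →
              lev j < lev a ∧ (lev j = 0 ∨ ∃ e', α j j e' (0, 0, 1) ≠ 0)))) ∧
        ∃ θ : ℝ, 1 / 2 < θ ∧ θ ≤ 1 ∧ ∃ D : ℝ, 0 ≤ D ∧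
          ∀ ν : ℝ, 0 < ν → ∀ (X₀ : Fin 4 → ℝ) (s : ℝ), 0 < s → ∀ X : Fin 4 → ℤ → ℝ → ℝ,
          (∀ (i : Fin 4) (k : ℤ), X i k 0 = if k = 0 then X₀ i else 0) →
          (∀ (i : Fin 4) (k : ℤ), k < 0 → ∀ t : ℝ, X i k t = 0) →
          (∃ M : ℝ, ∀ (t : ℝ) (i : Fin 4) (k : ℤ), (1 + (1 + ε₀) ^ ((10 : ℝ) * k)) * |X i k t| ≤ M) →
          (∀ (i : Fin 4) (k : ℤ), Continuous (X i k)) →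
          (∀ (i : Fin 4) (k : ℤ), ∀ t ∈ Set.Icc (0 : ℝ) s, HasDerivWithinAt (X i k)
            (Literature.Analysis.FluidPDE.TaoCascade.quadTerm ε₀ α X i k t - ν * (1 + ε₀) ^ ((2 : ℝ) * k) * X i k t)
            (Set.Icc (0 : ℝ) s) t) →
          (∀ t ∈ Set.Icc (0 : ℝ) s, ∀ (i : Fin 4) (k : ℤ), 1 ≤ k → 0 ≤ X i k t) →
          ∀ t ∈ Set.Icc (0 : ℝ) s, ∀ i, lev i = 0 → ∀ k : ℕ,
            (1 + ε₀) ^ (2 * θ * (k : ℝ)) * ((1 / 2 : ℝ) * X i (k : ℤ) t ^ 2) ≤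
              D * (∑ j : Fin 4, (1 / 2 : ℝ) * X₀ j ^ 2)) :
    ∃ j : ℕ, (j = 2 ∨ j = 3) ∧ ∃ θ : ℝ, 1 / 2 < θ ∧ θ ≤ 1 ∧ ∃ D : ℝ, 0 ≤ D ∧
      ∀ ν : ℝ, 0 < ν → ∀ (A s : ℝ), 0 < s → ∀ (C : ℤ → ℝ),
      (∀ m : ℤ, C m = (1 + ε₀) ^ (-((15 : ℝ) / 8)) * ((1 + ε₀) ^ ((1 : ℝ) / 4)) ^ ((5 : ℝ) * (m : ℝ) / 2)) →
      ∀ Z : ℤ → ℝ → ℝ,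
      (∀ m : ℤ, Z m 0 = if m = 0 then A else 0) →
      (∀ m : ℤ, m < 0 → ∀ t : ℝ, Z m t = 0) →
      (∃ M : ℝ, ∀ (t : ℝ) (m : ℤ), (1 + (1 + ε₀) ^ ((10 : ℝ) * ((m / 4 : ℤ) : ℝ))) * |Z m t| ≤ M) →
      (∀ m : ℤ, Continuous (Z m)) →
      (∀ k : ℤ, ∀ t ∈ Set.Icc (0 : ℝ) s, HasDerivWithinAt (Z (4 * k))
        (C (4 * (k - 1) + 3) * Z (4 * (k - 1) + 3) t ^ 2 - C (4 * k) * (Z (4 * k) t * Z (4 * k + 1) t) -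
          ν * (1 + ε₀) ^ ((2 : ℝ) * k) * Z (4 * k) t) (Set.Icc (0 : ℝ) s) t) →
      (∀ k : ℤ, ∀ t ∈ Set.Icc (0 : ℝ) s, HasDerivWithinAt (Z (4 * k + 1))
        (C (4 * k) * Z (4 * k) t ^ 2 - C (4 * k + 1) * (Z (4 * k + 1) t * Z (4 * k + 2) t) -
          ν * (1 + ε₀) ^ ((2 : ℝ) * k) * Z (4 * k + 1) t) (Set.Icc (0 : ℝ) s) t) →
      (∀ k : ℤ, ∀ t ∈ Set.Icc (0 : ℝ) s, HasDerivWithinAt (Z (4 * k + 2))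
        (C (4 * k + 1) * Z (4 * k + 1) t ^ 2 - C (4 * k + 2) * (Z (4 * k + 2) t * Z (4 * k + 3) t) -
          ν * (1 + ε₀) ^ ((2 : ℝ) * k) * Z (4 * k + 2) t) (Set.Icc (0 : ℝ) s) t) →
      (∀ k : ℤ, ∀ t ∈ Set.Icc (0 : ℝ) s, HasDerivWithinAt (Z (4 * k + 3))
        (C (4 * k + 2) * Z (4 * k + 2) t ^ 2 - C (4 * k + 3) * (Z (4 * k + 3) t * Z (4 * (k + 1)) t) -
          ν * (1 + ε₀) ^ ((2 : ℝ) * k) * Z (4 * k + 3) t) (Set.Icc (0 : ℝ) s) t) →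
      (∀ t ∈ Set.Icc (0 : ℝ) s, ∀ m : ℤ, 4 ≤ m → 0 ≤ Z m t) →
      ∀ t ∈ Set.Icc (0 : ℝ) s, ∀ k : ℕ,
        (1 + ε₀) ^ (2 * θ * (k : ℝ)) * ((1 / 2 : ℝ) * Z (4 * (k : ℤ) + j) t ^ 2) ≤ D * ((1 / 2 : ℝ) * A ^ 2) := by
  obtain ⟨α, P₀, P₁, P₂, hT, hO, hD, hw, hP, hCz, hP0, hP1, hP2, t0, t1, t2, t3⟩ := pumpLadder_nonempty hε hε1
  obtain ⟨hs, hc, _⟩ := hT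
  obtain ⟨j, hj, θ, hθ, hθ1, D, hD0, H⟩ :=
    pumpLadder_chainBarrier_of_primaryGraded ⟨hs, hc, ‹_›⟩ hO hD hw hP one_ne_zero (ne_of_gt hP2) (hAll α)
  refine ⟨(j : ℕ), ?_, θ, hθ, hθ1, D, hD0, ?_⟩
  · rcases hj with rfl | rfl
    · exact Or.inl rfl
    · exact Or.inr rfl
  intro ν hν A s hs0 C hC Z hZ0 hZneg hZM hZc hZ0ode hZ1ode hZ2ode hZ3ode hZpos t ht k
  -- the embedded table solution `X i k = z_{4k+i}`
  have v0 : ((0 : Fin 4) : ℕ) = 0 := rfl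
  have v1 : ((1 : Fin 4) : ℕ) = 1 := rfl
  have v2 : ((2 : Fin 4) : ℕ) = 2 := rfl
  have v3 : ((3 : Fin 4) : ℕ) = 3 := rfl
  have hfin : ∀ i : Fin 4, i = 0 ∨ i = 1 ∨ i = 2 ∨ i = 3 := by
    intro i; fin_cases i <;> simp
  -- bond coefficients of the ladder = the chain's coefficients at ratio `B`
  have hc0 : ∀ n : ℤ, C (4 * n) = P₀ * (1 + ε₀) ^ ((5 : ℝ) * n / 2) := fun n => by rw [hC, t0]
  have hc1 : ∀ n : ℤ, C (4 * n + 1) = P₁ * (1 + ε₀) ^ ((5 : ℝ) * n / 2) := fun n => by rw [hC, t1]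
  have hc2 : ∀ n : ℤ, C (4 * n + 2) = P₂ * (1 + ε₀) ^ ((5 : ℝ) * n / 2) := fun n => by rw [hC, t2]
  have hc3 : ∀ n : ℤ, C (4 * n + 3) = (1 : ℝ) * (1 + ε₀) ^ ((5 : ℝ) * n / 2) := fun n => by rw [hC, t3]
  have key := H ν hν (fun i => if i = 0 then A else 0) s hs0 (fun i n τ => Z (4 * n + (i : ℕ)) τ) ?_ ?_ ?_ ?_ ?_ ?_
    t ht k
  · -- conclusion
    have hE : (∑ i : Fin 4, (1 / 2 : ℝ) * (if i = 0 then A else 0) ^ 2) = (1 / 2 : ℝ) * A ^ 2 := by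
      simp
    rw [hE] at key
    simpa using key
  · -- datum
    intro i n
    have hi := i.isLt
    show Z (4 * n + (i : ℕ)) 0 = _
    rw [hZ0]
    by_cases hn : n = 0
    · subst hn
      by_cases hi0 : i = 0
      · subst hi0; simp
      · have : (i : ℕ) ≠ 0 := fun h => hi0 (Fin.ext h)
        have hne : (4 * (0 : ℤ) + ((i : ℕ) : ℤ)) ≠ 0 := by omega
        simp [hi0, this]
    · have hne : (4 * n + ((i : ℕ) : ℤ)) ≠ 0 := by omega
      simp [hn, hne]
  · -- vanishing at negative shells
    intro i n hn τ
    have hi := i.isLt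
    show Z (4 * n + (i : ℕ)) τ = 0
    exact hZneg _ (by omega) τ
  · -- Tao's weight bound
    obtain ⟨M, hM⟩ := hZM
    refine ⟨M, fun τ i n => ?_⟩
    have hi := i.isLt
    have hdiv : ((4 * n + ((i : ℕ) : ℤ)) / 4 : ℤ) = n := by omega
    have := hM τ (4 * n + (i : ℕ))
    rw [hdiv] at this
    exact this
  · -- continuity
    intro i n
    exact hZc _
  · -- the equations of motion: the ladder's `quadTerm` IS the chain's nonlinearity (`pumpLadder_chain_step`)
    intro i n τ hτ
    obtain ⟨q0, q1, q2, q3⟩ := pumpLadder_chain_step hs hc hO hD hw hP hCz ε₀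
      (fun i n τ => Z (4 * n + (i : ℕ)) τ) n τ C hc0 hc1 hc2 hc3
    rcases hfin i with rfl | rfl | rfl | rfl
    · rw [q0]
      simp only [v0, v1, v3, Nat.cast_zero, Nat.cast_one, Nat.cast_ofNat, add_zero]
      exact hZ0ode n τ hτ
    · rw [q1]
      simp only [v0, v1, v2, Nat.cast_zero, Nat.cast_one, Nat.cast_ofNat, add_zero]
      exact hZ1ode n τ hτ
    · rw [q2]
      simp only [v1, v2, v3, Nat.cast_one, Nat.cast_ofNat]
      exact hZ2ode n τ hτ
    · rw [q3]
      simp only [v0, v2, v3, Nat.cast_zero, Nat.cast_ofNat, add_zero]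
      exact hZ3ode n τ hτ
  · -- non-negativity on the shells `≥ 1` = sites `≥ 4`
    intro τ hτ i n hn
    have hi := i.isLt
    show 0 ≤ Z (4 * n + (i : ℕ)) τ
    exact hZpos τ hτ _ (by omega)

end Summit.NavierStokesRegularity.NavierStokesRegularity.Theorems

end
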